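import Summits.Schanuel.Schanuel.Theorems.DiophantineDichotomyApproximationPropertyCycleAPIAt3Defs
import Summits.Schanuel.Schanuel.Theorems.DiophantineDichotomyApproximationPropertyCycleAPThreeDichotomy
import Summits.Schanuel.Schanuel.Theorems.DiophantineDichotomyApproximationPropertyCurveHilbertLB
import Literature.NumberTheory.Transcendental.NesterenkoEliminationCor410Proofs
import HarnessLib

/-!
# Stub plan `CycleAPIAt3`, P4: the restart on a close container (crux `ApproximationProperty`, stmt-Schanuel-6117)

Crux `stmt-Schanuel-6117` (`Summit.Schanuel.Schanuel.Theses.DiophantineDichotomy.ApproximationProperty`),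
line `orbit-interpolation-determinant`, registered stub `stub_containerRestart : ContainerRestart`
(stub plan `Cruxes/ApproximationProperty/STUB-PLAN-CycleAPIAt3.md`, P4; vocabulary
`…CycleAPIAt3Defs.lean`: `ContainerRestart`).

A `ℚ`-curve `V(𝔮)` (`𝔮` a homogeneous prime of rank `2`, `δ = deg 𝔮`, `h = h(𝔮)`) lying on the
complete intersection `(Q, R)` of `ℙ³` (`(Q)` prime of degree `a`, `R ∉ (Q)` of degree `b`,
`a + b ≤ 3Δ`) all of whose nearest zeros are within `ρ ≤ exp(−C(Δ/c + 1)(Δ h + Y δ))` of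
`ω̄ = (1 : ω)` is RE-CUT: this is the construction of the landed third cut
(`CycleAP3Dichotomy.cut3_exposed`, `CycleAP3PrimeOfCurve.cut3`) run once more, with two changes —
the smallness of the container now comes from `ρ` through LNM 1752 Ch. 3 Cor. 4.10
(`|𝔮(ω̄)| ≤ ρ e^{45 deg 𝔮}`, `NesterenkoPhilippon2001_ch3_cor_4_10_holds`) instead of from the
descent, and the bookkeeping targets the output shape of `ContainerRestart`:

* the cut form `P₃ ∉ 𝔮` of degree `b₃ = a + b + ⌊Δ⌋ ≤ 4Δ` by the landed box principle modulo `𝔮`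
  (`boxPrinciple_modIdeal`) over `≥ ⌊Δ⌋ deg 𝔮` standard monomials (landed
  `curveHilbert_lowerBound`), with the adaptive height `h₃ = 4(S + c_B(b₃ + 1))/(⌊Δ⌋ deg 𝔮)`,
  `S = C(Δ/c + 1)(Δ h + Y δ)`, so that `log ‖P₃‖_ω̄ ≤ −S`;
* ONE application of the landed descent step `small_prime_of_cut` (`m = 3`, `r = 2`, weights
  `(Δ, Y)`, `U = S − 45δ − (h(P₃) δ + h b₃ + 99 δ b₃) ≥ S/2`), selecting a prime orbit `𝔯 ⊇ 𝔮`
  with `deg 𝔯 ≤ δ b₃ ≤ 4Δδ`, `h(𝔯) ≤ C(Δ h + Y δ)`, `log |𝔯(ω̄)| ≤ −(Δ h(𝔯) + Y deg 𝔯)/c`;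
* real bookkeeping with the constant `C = 3000 (c_B + 1)` (`ContainerRestartProof.arith_*`).

Proofs only (no definitions, no named facts). Sources: Nesterenko–Philippon (eds.), LNM 1752
(2001), Ch. 3 §4 (Prop. 4.7, Cor. 4.10, Prop. 4.11, Prop. 4.13, pp. 39–41); Philippon, J. Number
Theory 81 (2000) (AP1, `n = 3`).
-/

noncomputable section

-- `Summit.Schanuel.Schanuel.…` is the mandated summit/sub-problem namespace (single-conjunct summit), hence:
set_option linter.dupNamespace false

namespace Summit.Schanuel.Schanuel.Cruxes.ApproximationProperty.OrbitInterpolationDeterminant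

open Literature.NumberTheory.Transcendental Literature.NumberTheory.Transcendental.Nesterenko
open Literature.NumberTheory.Transcendental.PhilipponMain (cons_one_ne_zero one_le_norm_cons_one
  ringKrullDim_quotient_eq_of_isUnmixedOfRank)
open MvPolynomial Real Module
open Literature.RingTheory.MvPolynomial (idealDegree)
open scoped BigOperators

namespace ContainerRestartProof

/-! ## Real arithmetic of the restart -/

/-- The size `S = C(Δ/c + 1)X` of the container against the scale: `S ≤ 2ΔX`, `2CX ≤ S` and
`CΔX ≤ cS` for `0 < C ≤ c ≤ Δ`, `X ≥ 0`. [folklore] -/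
theorem arith_S {C c Δ X : ℝ} (hC0 : 0 < C) (hCc : C ≤ c) (hcΔ : c ≤ Δ) (hX : 0 ≤ X) :
    C * (Δ / c + 1) * X ≤ Δ * (2 * X) ∧ 2 * C * X ≤ C * (Δ / c + 1) * X ∧
      C * Δ * X ≤ c * (C * (Δ / c + 1) * X) := by
  have hc0 : 0 < c := by linarith
  have hΔc : 1 ≤ Δ / c := by rw [le_div_iff₀ hc0]; linarith
  have e : c * (Δ / c) = Δ := mul_div_cancel₀ Δ hc0.ne'
  have h1 : C * (Δ / c) ≤ Δ := by
    have h2 : C * (Δ / c) ≤ c * (Δ / c) := mul_le_mul_of_nonneg_right hCc (by linarith)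
    linarith
  refine ⟨?_, ?_, ?_⟩
  · have h3 : C * (Δ / c + 1) ≤ 2 * Δ := by linarith
    calc C * (Δ / c + 1) * X ≤ 2 * Δ * X := mul_le_mul_of_nonneg_right h3 hX
      _ = Δ * (2 * X) := by ring
  · have h3 : 2 * C ≤ C * (Δ / c + 1) := by nlinarith
    exact mul_le_mul_of_nonneg_right h3 hX
  · have h3 : c * (C * (Δ / c + 1) * X) = C * Δ * X + c * C * X := by
      have h4 : c * (C * (Δ / c + 1) * X) = C * (c * (Δ / c)) * X + c * C * X := by ring
      rw [h4, e]
    rw [h3]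
    nlinarith [mul_nonneg (mul_nonneg hc0.le hC0.le) hX]

/-- The budget of the cut: with `C ≥ 3000(c_B + 1)`, `C ≤ Δ ≤ Y`, `deg 𝔮 ≥ 1`, `b₃ ≤ 4Δ`,
`h(P₃) deg 𝔮 ≤ 16X + 40 c_B` and `2CX ≤ S` (`X = Δ h + Y deg 𝔮`), the loss `45 deg 𝔮` of
Cor. 4.10 plus the cost of Prop. 4.11 plus `54 deg 𝔮 b₃` is at most `S/2`. [folklore] -/
theorem arith_U {C cB Δ Y δ h hP b₃ X S : ℝ} (hC : 3000 * (cB + 1) ≤ C) (hcB : 0 < cB)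
    (hCΔ : C ≤ Δ) (hΔY : Δ ≤ Y) (hδ : 1 ≤ δ) (hh : 0 ≤ h) (hb₃ : b₃ ≤ 4 * Δ)
    (hX : X = Δ * h + Y * δ) (hK : hP * δ ≤ 16 * X + 40 * cB) (hS : 2 * C * X ≤ S) :
    45 * δ + hP * δ + h * b₃ + 99 * δ * b₃ + 54 * δ * b₃ ≤ S / 2 := by
  subst hX
  have hΔ1 : 1 ≤ Δ := by nlinarith
  have hΔ0 : 0 ≤ Δ := by linarith
  have hY0 : 0 ≤ Y := by linarith
  have hδ0 : 0 ≤ δ := by linarith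
  have hΔh : 0 ≤ Δ * h := by positivity
  have hYδ : Y * 1 ≤ Y * δ := mul_le_mul_of_nonneg_left hδ hY0
  have hX1 : 1 ≤ Δ * h + Y * δ := by linarith
  have p1 : 45 * δ * 1 ≤ 45 * δ * Y := mul_le_mul_of_nonneg_left (by linarith) (by positivity)
  have p2 : h * b₃ ≤ h * (4 * Δ) := mul_le_mul_of_nonneg_left hb₃ hh
  have p3 : δ * b₃ ≤ δ * (4 * Δ) := mul_le_mul_of_nonneg_left hb₃ hδ0
  have p4 : Δ * δ ≤ Y * δ := mul_le_mul_of_nonneg_right hΔY hδ0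
  have p5 : 40 * cB * 1 ≤ 40 * cB * (Δ * h + Y * δ) :=
    mul_le_mul_of_nonneg_left hX1 (by positivity)
  have p6 : (677 + 40 * cB) * (Δ * h + Y * δ) ≤ C * (Δ * h + Y * δ) :=
    mul_le_mul_of_nonneg_right (by linarith) (by linarith)
  linarith

/-- The height budget of the selected prime: `h b₃ + h(P₃) deg 𝔮 + 18 deg 𝔮 b₃ ≤ C X` once
`C ≥ 92 + 40 c_B`. [folklore] -/
theorem arith_height {C cB Δ Y δ h hP b₃ X : ℝ} (hC : 92 + 40 * cB ≤ C) (hcB : 0 < cB)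
    (hΔ1 : 1 ≤ Δ) (hΔY : Δ ≤ Y) (hδ : 1 ≤ δ) (hh : 0 ≤ h) (hb₃ : b₃ ≤ 4 * Δ)
    (hX : X = Δ * h + Y * δ) (hK : hP * δ ≤ 16 * X + 40 * cB) :
    h * b₃ + hP * δ + 18 * δ * b₃ ≤ C * X := by
  subst hX
  have hY0 : 0 ≤ Y := by linarith
  have hδ0 : 0 ≤ δ := by linarith
  have hΔh : 0 ≤ Δ * h := by positivity
  have hYδ : Y * 1 ≤ Y * δ := mul_le_mul_of_nonneg_left hδ hY0
  have hX1 : 1 ≤ Δ * h + Y * δ := by linarith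
  have p2 : h * b₃ ≤ h * (4 * Δ) := mul_le_mul_of_nonneg_left hb₃ hh
  have p3 : δ * b₃ ≤ δ * (4 * Δ) := mul_le_mul_of_nonneg_left hb₃ hδ0
  have p4 : Δ * δ ≤ Y * δ := mul_le_mul_of_nonneg_right hΔY hδ0
  have p5 : 40 * cB * 1 ≤ 40 * cB * (Δ * h + Y * δ) :=
    mul_le_mul_of_nonneg_left hX1 (by positivity)
  have p6 : (92 + 40 * cB) * (Δ * h + Y * δ) ≤ C * (Δ * h + Y * δ) :=
    mul_le_mul_of_nonneg_right hC (by linarith)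
  linarith

/-- The RATE of the selected prime: `2T ≤ cU` for the a-priori total weight
`T = Δ(h b₃ + h(P₃) deg 𝔮 + 18 deg 𝔮 b₃) + Y deg 𝔮 b₃` of the cut, once `U ≥ S/2`, `CΔX ≤ cS`
and `C ≥ 3000(c_B + 1)`. [folklore] -/
theorem arith_rate {C c cB Δ Y δ h hP b₃ X S U : ℝ} (hC : 3000 * (cB + 1) ≤ C) (hcB : 0 < cB)
    (hCc : C ≤ c) (hcΔ : c ≤ Δ) (hΔY : Δ ≤ Y) (hδ : 1 ≤ δ) (hh : 0 ≤ h) (hb₃ : b₃ ≤ 4 * Δ)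
    (hX : X = Δ * h + Y * δ) (hK : hP * δ ≤ 16 * X + 40 * cB) (hS : C * Δ * X ≤ c * S)
    (hU : S / 2 ≤ U) :
    2 * (Δ * (h * b₃ + hP * δ + 18 * δ * b₃) + Y * (δ * b₃)) ≤ c * U := by
  have hc0 : 0 < c := by nlinarith
  have hΔ1 : 1 ≤ Δ := by nlinarith
  have hΔ0 : 0 ≤ Δ := by linarith
  have hY0 : 0 ≤ Y := by linarith
  have hδ0 : 0 ≤ δ := by linarith
  have hΔh : 0 ≤ Δ * h := by positivity
  have hYδ : Y * 1 ≤ Y * δ := mul_le_mul_of_nonneg_left hδ hY0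
  have hX1 : 1 ≤ X := by rw [hX]; linarith
  have hX0 : 0 ≤ X := by linarith
  have hΔX : Δ * h ≤ X := by rw [hX]; nlinarith
  have hYX : Y * δ ≤ X := by rw [hX]; linarith
  have q1 : Δ * (h * b₃) ≤ Δ * (h * (4 * Δ)) :=
    mul_le_mul_of_nonneg_left (mul_le_mul_of_nonneg_left hb₃ hh) hΔ0
  have q2 : Δ * (Δ * h) ≤ Δ * X := mul_le_mul_of_nonneg_left hΔX hΔ0
  have q3 : Δ * (hP * δ) ≤ Δ * (16 * X + 40 * cB) := mul_le_mul_of_nonneg_left hK hΔ0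
  have q4 : Δ * (δ * b₃) ≤ Δ * (δ * (4 * Δ)) :=
    mul_le_mul_of_nonneg_left (mul_le_mul_of_nonneg_left hb₃ hδ0) hΔ0
  have q5 : Δ * (Δ * δ) ≤ Δ * (Y * δ) :=
    mul_le_mul_of_nonneg_left (mul_le_mul_of_nonneg_right hΔY hδ0) hΔ0
  have q6 : Δ * (Y * δ) ≤ Δ * X := mul_le_mul_of_nonneg_left hYX hΔ0
  have q7 : Y * (δ * b₃) ≤ Y * (δ * (4 * Δ)) :=
    mul_le_mul_of_nonneg_left (mul_le_mul_of_nonneg_left hb₃ hδ0) hY0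
  have q8 : Δ * (40 * cB) * 1 ≤ Δ * (40 * cB) * X := mul_le_mul_of_nonneg_left hX1 (by positivity)
  have q9 : (192 + 80 * cB) * (Δ * X) ≤ C / 2 * (Δ * X) :=
    mul_le_mul_of_nonneg_right (by linarith) (by positivity)
  have q10 : c * (S / 2) ≤ c * U := mul_le_mul_of_nonneg_left hU hc0.le
  linarith

/-- The value of the container from its distance to `ω̄`: `|𝔮(ω̄)| ≤ ρ e^{45 deg 𝔮}` (Cor. 4.10 with
`m = 3`) and `ρ ≤ e^{−S}` give `|𝔮(ω̄)| ≤ e^{−S + 45 deg 𝔮}`.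
[cite: NesterenkoPhilippon2001, Ch. 3 Cor. 4.10 (p. 40)] -/
theorem iabs_le_of_rho_le {𝔮 : Ideal (Rx 3)} {ω₁ : Fin (3 + 1) → ℂ} {S : ℝ} (h𝔮 : 𝔮.IsPrime)
    (hhom : letI := MvPolynomial.gradedAlgebra (σ := Fin (3 + 1)) (R := ℚ);
      𝔮.IsHomogeneous (homogeneousSubmodule (Fin (3 + 1)) ℚ))
    (hunm : IsUnmixedOfRank 𝔮 2) (hω₁ : ω₁ ≠ 0) (hρ : rho ω₁ 𝔮 ≤ exp (-S)) :
    iabs 𝔮 2 ω₁ ≤ exp (-S + 45 * (ideg 𝔮 2 : ℝ)) := by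
  letI := MvPolynomial.gradedAlgebra (σ := Fin (3 + 1)) (R := ℚ)
  have hcor := NesterenkoPhilippon2001_ch3_cor_4_10_holds 3 2 𝔮 (by norm_num) (by norm_num) h𝔮
    hhom hunm ω₁ hω₁
  have h1 : rho ω₁ 𝔮 * exp (5 * ((3 : ℕ) : ℝ) ^ 2 * (ideg 𝔮 2 : ℝ)) ≤
      exp (-S) * exp (5 * ((3 : ℕ) : ℝ) ^ 2 * (ideg 𝔮 2 : ℝ)) :=
    mul_le_mul_of_nonneg_right hρ (exp_pos _).le
  rw [← exp_add] at h1
  refine hcor.trans (h1.trans (le_of_eq ?_))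
  congr 1
  push_cast
  ring

/-! ## The assembly -/

/-- **The restart on a close container** (curried content of the registered stub
`stub_containerRestart`, for one `ω ∈ ℂ³`): with `C = 3000(c_B + 1)` (`c_B` the constant of the
box principle modulo an ideal at `ω`), a prime `ℚ`-curve `V(𝔮) ⊆ V(Q, R)` (`a + b ≤ 3Δ`) with
`ρ(ω̄, V(𝔮)) ≤ exp(−C(Δ/c + 1)(Δ h(𝔮) + Y deg 𝔮))`, `C ≤ c ≤ Δ ≤ Y`, is re-cut by a form
`P₃ ∉ 𝔮` of degree `a + b + ⌊Δ⌋` (box principle modulo `𝔮` over `⌊Δ⌋ deg 𝔮` standard monomials,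
adaptive height; value of the container by Cor. 4.10) and `small_prime_of_cut` (`m = 3`, `r = 2`,
weights `(Δ, Y)`) selects a prime orbit `𝔯 ⊇ 𝔮` with `deg 𝔯 ≤ 4Δ deg 𝔮`,
`h(𝔯) ≤ C(Δ h(𝔮) + Y deg 𝔮)`, `|𝔯(ω̄)| ≤ exp(−(Δ h(𝔯) + Y deg 𝔯)/c)`.
[cite: NesterenkoPhilippon2001, Ch. 3 Prop. 4.7, Cor. 4.10, Prop. 4.11, Prop. 4.13 (pp. 39–41)] -/
theorem main (ω : Fin 3 → ℂ) : ∃ C : ℝ, 1 ≤ C ∧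
    ∀ (Q R : Rx 3) (a b : ℕ) (𝔮 : Ideal (Rx 3)),
      Q ≠ 0 → Q.IsHomogeneous a → R.IsHomogeneous b → 1 ≤ a → 1 ≤ b →
      (Ideal.span {Q}).IsPrime → R ∉ Ideal.span {Q} →
      𝔮.IsPrime → (letI := MvPolynomial.gradedAlgebra (σ := Fin (3 + 1)) (R := ℚ);
        𝔮.IsHomogeneous (homogeneousSubmodule (Fin (3 + 1)) ℚ)) → IsUnmixedOfRank 𝔮 2 →
      Q ∈ 𝔮 → R ∈ 𝔮 →
    ∀ (c Δ Y : ℝ), C ≤ c → c ≤ Δ → Δ ≤ Y → (a : ℝ) + b ≤ 3 * Δ →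
      rho (Fin.cons 1 ω) 𝔮 ≤ Real.exp (-(C * (Δ / c + 1) * (Δ * iheight 𝔮 2 + Y * ideg 𝔮 2))) →
      ∃ 𝔯 : Ideal (Rx 3), 𝔯.IsPrime ∧ (letI := MvPolynomial.gradedAlgebra (σ := Fin (3 + 1)) (R := ℚ);
        𝔯.IsHomogeneous (homogeneousSubmodule (Fin (3 + 1)) ℚ)) ∧
        IsUnmixedOfRank 𝔯 1 ∧ 𝔮 ≤ 𝔯 ∧
        (ideg 𝔯 1 : ℝ) ≤ 4 * Δ * ideg 𝔮 2 ∧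
        iheight 𝔯 1 ≤ C * (Δ * iheight 𝔮 2 + Y * ideg 𝔮 2) ∧
        iabs 𝔯 1 (Fin.cons 1 ω) ≤ Real.exp (-((Δ * iheight 𝔯 1 + Y * ideg 𝔯 1) / c)) := by
  classical
  obtain ⟨cB, hcB, hBox⟩ := boxPrinciple_modIdeal 3 ω
  set ω₁ : Fin (3 + 1) → ℂ := Fin.cons 1 ω with hω₁def
  have hω₁ : ω₁ ≠ 0 := cons_one_ne_zero ω
  have hΘ : 1 ≤ ‖ω₁‖ := one_le_norm_cons_one ω
  -- the constant
  set C : ℝ := 3000 * (cB + 1) with hCdef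
  have hC3k : 3000 * (cB + 1) ≤ C := hCdef.symm.le
  have hC3000 : 3000 ≤ C := by linarith
  have hC92 : 92 + 40 * cB ≤ C := by linarith
  have hC1 : 1 ≤ C := by linarith
  have hC0 : 0 < C := by linarith
  refine ⟨C, hC1, ?_⟩
  intro Q R a b 𝔮 hQ0 hQhom hRhom ha1 hb1 hQprime hRQ hqprime hqhom hqunm hQq hRq c Δ Y hCc hcΔ
    hΔY hab3 hρ
  have hΔ1 : 1 ≤ Δ := by linarith
  have hΔ0 : 0 < Δ := by linarith
  have hY0 : 0 ≤ Y := by linarith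
  have hYpos : 0 < Y := by linarith
  have hc0 : 0 < c := by linarith
  -- the curve's degree `δ ≥ 1` and height `h ≥ 0`; `X = Δ h + Y δ`, `S = C(Δ/c + 1)X`
  have hδ1n : 1 ≤ ideg 𝔮 2 :=
    Literature.Barriers.Schanuel.one_le_ideg_of_isPrime NesterenkoPhilippon2001_ch3_prop_4_4_holds
      (by norm_num) (by norm_num) hqprime hqhom hqunm
  set δ : ℝ := (ideg 𝔮 2 : ℝ) with hδdef
  have hδ1 : 1 ≤ δ := by rw [hδdef]; exact_mod_cast hδ1n
  have hδ0 : 0 < δ := by linarith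
  set h : ℝ := iheight 𝔮 2 with hhdef
  have hh0 : 0 ≤ h := height_nonneg _
  set X : ℝ := Δ * h + Y * δ with hXdef
  have hX0 : 0 ≤ X := by rw [hXdef]; positivity
  set S : ℝ := C * (Δ / c + 1) * X with hSdef
  obtain ⟨hS2Δ, hS2C, hScΔ⟩ := arith_S hC0 hCc hcΔ hX0
  rw [← hSdef] at hS2Δ hS2C hScΔ
  have hS0 : 0 ≤ S := by nlinarith
  -- the container's value at `ω₁` (Cor. 4.10)
  have habs : iabs 𝔮 2 ω₁ ≤ exp (-S + 45 * δ) := iabs_le_of_rho_le hqprime hqhom hqunm hω₁ hρ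
  -- the degree `g = ⌊Δ⌋` of the extra factor and `b₃ = a + b + g`
  obtain ⟨g, hgdef⟩ : ∃ g : ℕ, g = ⌊Δ⌋₊ := ⟨_, rfl⟩
  obtain ⟨-, hg10, hgΔ, hΔg⟩ :=
    CycleAPITwo.floor_facts (a := 0) (by exact_mod_cast hΔ0.le) (by linarith : (10 : ℝ) ≤ Δ)
  rw [← hgdef] at hg10 hgΔ hΔg
  have hg0 : (0 : ℝ) < g := by exact_mod_cast (show 0 < g by omega)
  obtain ⟨b₃, hb₃def⟩ : ∃ b₃ : ℕ, b₃ = a + b + g := ⟨_, rfl⟩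
  have hab : a + b ≤ b₃ := by omega
  have hb₃g : b₃ - a - b = g := by omega
  have hb₃1 : 1 ≤ b₃ := by omega
  have hb₃pos : 0 < b₃ := hb₃1
  have hb₃R : (b₃ : ℝ) ≤ 4 * Δ := by rw [hb₃def]; push_cast; linarith
  have hb₃0 : (0 : ℝ) ≤ b₃ := Nat.cast_nonneg _
  -- `M₃ = g deg 𝔮` free monomials of degree `b₃` modulo `𝔮` (curve Hilbert lower bound)
  have hdim : ringKrullDim (Rx 3 ⧸ 𝔮) = (2 : ℕ) :=
    ringKrullDim_quotient_eq_of_isUnmixedOfRank hqprime hqunm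
  have hHilb := curveHilbert_lowerBound Q R a b hQ0 hQhom hRhom ha1 hb1 hQprime hRQ 𝔮 hqprime hqhom
    hQq hRq hdim b₃ hab
  obtain ⟨M₃, hM₃def⟩ : ∃ M : ℕ, M = g * ideg 𝔮 2 := ⟨_, rfl⟩
  rw [hb₃g, ← hM₃def] at hHilb
  have hM₃8 : 8 ≤ M₃ := by
    have : 10 * 1 ≤ g * ideg 𝔮 2 := Nat.mul_le_mul hg10 hδ1n
    omega
  have hM₃R : (M₃ : ℝ) = (g : ℝ) * δ := by rw [hM₃def, Nat.cast_mul, hδdef]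
  have hM₃8R : (8 : ℝ) ≤ M₃ := by exact_mod_cast hM₃8
  have hfin : finrank ℚ ↥(homogeneousSubmodule (Fin (3 + 1)) ℚ b₃ ⊓ 𝔮.restrictScalars ℚ) + M₃ ≤
      finrank ℚ ↥(homogeneousSubmodule (Fin (3 + 1)) ℚ b₃) := by
    have e : finrank ℚ ↥(homogeneousSubmodule (Fin (3 + 1)) ℚ b₃ ⊓ 𝔮.restrictScalars ℚ) =
        finrank ℚ ↥(idealDegree 𝔮 b₃) := by
      rw [idealDegree, inf_comm]
    rw [e]
    omega
  have hqI : ∀ f ∈ 𝔮, ∀ d : ℕ, homogeneousComponent d f ∈ 𝔮 := fun f hf d =>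
    MvPolynomial.homogeneousComponent_mem_of_mem hqhom hf d
  -- the adaptive height `h₃` and the box `N₃ = ⌊e^{h₃}⌋`
  set h₃ : ℝ := 4 * (S + cB * (b₃ + 1)) / (g * δ) with hh₃def
  have hh₃0 : 0 ≤ h₃ := by rw [hh₃def]; positivity
  have hh₃eq : h₃ * (g * δ) = 4 * (S + cB * (b₃ + 1)) := by
    rw [hh₃def]
    exact div_mul_cancel₀ _ (by positivity)
  obtain ⟨N₃, hN₃def⟩ : ∃ N : ℕ, N = ⌊exp h₃⌋₊ := ⟨_, rfl⟩
  obtain ⟨hN1, hlogN, hlogN1⟩ := CycleAPITwo.box_facts hh₃0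
  rw [← hN₃def] at hN1 hlogN hlogN1
  -- the cut form `P₃ ∉ 𝔮`
  obtain ⟨P₃, hP₃q, hP₃hom, hP₃1, -, hhP₃, hP₃val⟩ := hBox 𝔮 b₃ N₃ M₃ hqI hN1 (by omega) hfin
  set hP : ℝ := height P₃ with hPdef
  have hP0 : 0 ≤ hP := height_nonneg _
  have hPh₃ : hP ≤ h₃ := hhP₃.trans hlogN
  have hK : hP * δ ≤ 16 * X + 40 * cB := by
    have h1 : hP * δ ≤ h₃ * δ := mul_le_mul_of_nonneg_right hPh₃ hδ0.le
    have hX2 : 0 ≤ 2 * X := by positivity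
    have h2 := CycleAP3PrimeOfCurve.h3delta_le (cB := cB) (b₃ := (b₃ : ℝ)) hX2 hS2Δ hcB hΔ1 hΔg
      hδ0 hb₃R
    rw [← hh₃def] at h2
    linarith
  -- smallness of the cut form at `ω₁`
  have hnorm : normAt ω₁ P₃ ≤ exp (-S) := by
    have h1 : normAt ω₁ P₃ ≤ ‖aeval ω₁ P₃‖ := by
      rw [normAt]
      exact div_le_self (norm_nonneg _) (one_le_mul_of_one_le_of_one_le hP₃1 (one_le_pow₀ hΘ))
    refine h1.trans (hP₃val.trans (exp_le_exp.mpr ?_))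
    exact CycleAP3PrimeOfCurve.arith_box3 hS0 hcB hb₃0 hg0 hδ0 hM₃R hM₃8R hh₃eq hlogN1
  -- the cut
  set U : ℝ := S - 45 * δ - (hP * δ + h * b₃ + 99 * δ * b₃) with hUdef
  have hcut : 45 * δ + hP * δ + h * b₃ + 99 * δ * b₃ + 54 * δ * b₃ ≤ S / 2 :=
    arith_U hC3k hcB (by linarith) hΔY hδ1 hh0 hb₃R hXdef hK hS2C
  have hδb : 0 ≤ δ * b₃ := by positivity
  have hUS : S / 2 ≤ U := by rw [hUdef]; linarith
  have hE : height P₃ * (ideg 𝔮 2 : ℝ) + iheight 𝔮 2 * (b₃ : ℝ) +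
      11 * ((3 : ℕ) : ℝ) ^ 2 * (ideg 𝔮 2 : ℝ) * (b₃ : ℝ) = hP * δ + h * b₃ + 99 * δ * b₃ := by
    rw [← hPdef, ← hhdef, ← hδdef]
    push_cast
    ring
  have hsmall : max (normAt ω₁ P₃) (iabs 𝔮 2 ω₁) *
      exp (height P₃ * (ideg 𝔮 2 : ℝ) + iheight 𝔮 2 * (b₃ : ℝ) +
        11 * ((3 : ℕ) : ℝ) ^ 2 * (ideg 𝔮 2 : ℝ) * (b₃ : ℝ)) ≤ exp (-U) := by
    refine CycleAPITwo.max_mul_exp_le hnorm habs ?_ ?_ <;> linarith [hE, hUdef]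
  have hU54 : 2 * ((3 : ℕ) : ℝ) ^ 3 * ((ideg 𝔮 2 : ℝ) * (b₃ : ℝ)) ≤ U := by
    rw [← hδdef]
    norm_num
    linarith
  obtain ⟨𝔯, h𝔯prime, h𝔯hom, h𝔯unm, hq𝔯, -, h𝔯deg, h𝔯h, h𝔯abs⟩ :=
    small_prime_of_cut 3 2 𝔮 P₃ b₃ ω₁ Δ Y U le_rfl (by norm_num) hqprime hqhom hqunm hP₃hom hb₃1
      hP₃q hω₁ hΔ0.le hY0 (by linarith) hsmall hU54
  simp only [show (2 : ℕ) - 1 = 1 from rfl] at h𝔯unm h𝔯deg h𝔯h h𝔯abs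
  rw [← hPdef, ← hhdef, ← hδdef] at h𝔯h h𝔯abs
  have h𝔯h0 : 0 ≤ iheight 𝔯 1 := height_nonneg _
  refine ⟨𝔯, h𝔯prime, h𝔯hom, h𝔯unm, hq𝔯, ?_, ?_, ?_⟩
  · -- degree `deg 𝔯 ≤ deg 𝔮 · b₃ ≤ 4Δ deg 𝔮`
    have h1 : (ideg 𝔯 1 : ℝ) ≤ δ * b₃ := by rw [hδdef]; exact_mod_cast h𝔯deg
    have h2 : δ * b₃ ≤ δ * (4 * Δ) := mul_le_mul_of_nonneg_left hb₃R hδ0.le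
    linarith
  · -- height budget
    have h1 : iheight 𝔯 1 ≤ h * b₃ + hP * δ + 18 * δ * b₃ := by
      refine h𝔯h.trans (le_of_eq ?_)
      push_cast
      ring
    exact h1.trans (arith_height hC92 hcB hΔ1 hΔY hδ1 hh0 hb₃R hXdef hK)
  · -- accuracy at the registered rate `1/c`
    have hrate := arith_rate (hP := hP) hC3k hcB hCc hcΔ hΔY hδ1 hh0 hb₃R hXdef hK hScΔ hUS
    have hb₃posR : (0 : ℝ) < b₃ := by exact_mod_cast hb₃pos
    refine h𝔯abs.trans (CycleAP3PrimeOfCurve.exp_rate_le hc0 ?_ ?_ ?_)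
    · have h1 : 0 ≤ Δ * (h * b₃ + hP * δ + (3 * (2 + 1) + 3 ^ 2) * δ * b₃) := by positivity
      have h2 : 0 < Y * (δ * b₃) := mul_pos hYpos (mul_pos hδ0 hb₃posR)
      push_cast
      linarith
    · exact add_nonneg (mul_nonneg hΔ0.le h𝔯h0) (mul_nonneg hY0 (Nat.cast_nonneg _))
    · refine le_trans (le_of_eq ?_) hrate
      push_cast
      ring

end ContainerRestartProof

/-- **Registered stub `stub_containerRestart : ContainerRestart`** (crux `stmt-Schanuel-6117`, line
`orbit-interpolation-determinant`, stub plan P4): the restart on a close container — a prime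
`ℚ`-curve `V(𝔮)` on the complete intersection `(Q, R)` of `ℙ³` (`a + b ≤ 3Δ`) whose zeros come
within `exp(−C(Δ/c + 1)(Δ h(𝔮) + Y deg 𝔮))` of `ω̄ = (1 : ω)` is re-cut by a small form of degree
`a + b + ⌊Δ⌋` (box principle modulo `𝔮`, `curveHilbert_lowerBound`, Cor. 4.10 for the container's
own value) and `small_prime_of_cut` selects a small prime orbit `𝔯 ⊇ 𝔮` with
`deg 𝔯 ≤ 4Δ deg 𝔮`, `h(𝔯) ≤ C(Δ h(𝔮) + Y deg 𝔮)` and accuracy at constant `c`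
(`ContainerRestartProof.main`, `C = 3000(c_B + 1)`).
[cite: NesterenkoPhilippon2001, Ch. 3 Prop. 4.7, Cor. 4.10, Prop. 4.11, Prop. 4.13 (pp. 39–41)] -/
theorem stub_containerRestart : ContainerRestart := fun ω => ContainerRestartProof.main ω

end Summit.Schanuel.Schanuel.Cruxes.ApproximationProperty.OrbitInterpolationDeterminant

end
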